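import Summits.HubbardSuperconductivity.HubbardSuperconductivity.Theorems.ThermalWedgeTwSeededEnsembleEquivalenceRSourcedPressureLimitRegions

/-!
# Crux `TwSeededEnsembleEquivalenceR` (stmt-HubbardSuperconductivity-15581), line `cold-floor-collapse`
# (slug `Sketch`) — stub S3 `stub_sourcedPressureLimit`, layer 2b: filling and cut bounds for the
# regional Hamiltonians of a sourced Hubbard model on an abstract vertex set

Support file (`--supports stmt-HubbardSuperconductivity-15581`; sorry-free; no definition). Continuation of
`…RSourcedPressureLimitRegions.lean` (same defining hypotheses `hb`, `hH` for the bond operator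
`b i X Y` and the regional Hamiltonian `H R = V_R + Σ_i Σ_{X,Y ∈ R, st i X Y} b i X Y`): the two norm
bounds of Ruelle's subadditivity argument,

* **filling** (`norm_regionHam_univ_sub_le`): when each step relation is a partial bijection,
  `‖H Λ − H R‖ ≤ #Rᶜ·(|U| + 2|μ| + 4(4 + 4(‖κ₀‖ + ‖κ₁‖)))` (on-site terms outside `R` plus the at most
  `4 #Rᶜ` bonds not inside `R`);
* **cutting into blocks** (`norm_regionHam_univ_sub_sum_le`): for the fibres `R_j` of a block map `g`,
  `‖H Λ − Σ_j H R_j‖ ≤ (4 + 4(‖κ₀‖ + ‖κ₁‖)) Σ_i #P_i`, `P_i ⊇` the sites whose `i`-step leaves their block.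

Ruelle, *Statistical Mechanics* (1969) §2.2–2.3; Bratteli–Robinson II §6.2.4. [folklore]
-/

-- the mandated namespace `Summit.<Summit>.<Problem>.Theorems…` repeats `HubbardSuperconductivity`
set_option linter.dupNamespace false

namespace Summit.HubbardSuperconductivity.HubbardSuperconductivity.Theorems.TwSeededEnsembleEquivalenceR.ColdFloorLine

open Matrix Finset Literature.MathematicalPhysics.QuantumLattice
open Summit.HubbardSuperconductivity.HubbardSuperconductivity.Theorems.EnslavedA1g.UpperSandwich
open scoped ComplexOrder Matrix.Norms.L2Operator

noncomputable section

/-! ### Filling and cut bounds -/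

section Region

variable {Λ : Type*} [LinearOrder Λ] [Fintype Λ] {κ : Fin 2 → ℂ} {U μ : ℝ}
  {b : Fin 2 → Λ → Λ → Matrix (Finset (Orb Λ)) (Finset (Orb Λ)) ℂ}
  {st : Fin 2 → Λ → Λ → Prop} [∀ i, DecidableRel (st i)]
  {H : Finset Λ → Matrix (Finset (Orb Λ)) (Finset (Orb Λ)) ℂ}

/-- **Filling bound**: if each step relation is a partial bijection, the regional Hamiltonian of `R`
differs from that of all of `Λ` by the on-site terms outside `R` and the bonds not inside `R`:
`‖H Λ − H R‖ ≤ (|Λ| − #R) · (|U| + 2|μ| + 4 (4 + 4(‖κ₀‖ + ‖κ₁‖)))`. [folklore] -/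
theorem norm_regionHam_univ_sub_le
    (hb : ∀ (i : Fin 2) (X Y : Λ), b i X Y =
      (∑ σ : Fin 2, ((-1 : ℂ) • (creation (orb X σ) * annihilation (orb Y σ)) +
        ((-1 : ℂ) • (creation (orb X σ) * annihilation (orb Y σ)))ᴴ)) +
      (κ i • (annihilation (orb X 0) * annihilation (orb Y 1) - annihilation (orb X 1) * annihilation (orb Y 0)) +
        (κ i • (annihilation (orb X 0) * annihilation (orb Y 1) -
          annihilation (orb X 1) * annihilation (orb Y 0)))ᴴ))
    (hH : ∀ R : Finset Λ, H R = onSiteSum (U : ℂ) (μ : ℂ) R +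
      ∑ i : Fin 2, ∑ X : Λ, ∑ Y : Λ, if X ∈ R ∧ Y ∈ R ∧ st i X Y then b i X Y else 0)
    (hR : ∀ i X Y Y', st i X Y → st i X Y' → Y = Y') (hL : ∀ i X X' Y, st i X Y → st i X' Y → X = X')
    (R : Finset Λ) :
    ‖H Finset.univ - H R‖ ≤
      ((Fintype.card Λ - R.card : ℕ) : ℝ) * (|U| + 2 * |μ| + 4 * (4 + 4 * (‖κ 0‖ + ‖κ 1‖))) := by
  rw [← Finset.card_compl]
  set C : ℝ := 4 + 4 * (‖κ 0‖ + ‖κ 1‖) with hC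
  have hC0 : 0 ≤ C := by positivity
  have hκ : ∀ i : Fin 2, ‖κ i‖ ≤ ‖κ 0‖ + ‖κ 1‖ := fun i => by
    fin_cases i
    · exact le_add_of_nonneg_right (norm_nonneg _)
    · exact le_add_of_nonneg_left (norm_nonneg _)
  have hbC : ∀ i X Y, ‖b i X Y‖ ≤ C := fun i X Y =>
    (norm_bondOp'_le hb i X Y).trans (by rw [hC]; linarith [hκ i])
  -- the difference: on-site terms outside `R` plus the bonds not inside `R`
  have hdiff : H Finset.univ - H R = onSiteSum (U : ℂ) (μ : ℂ) Rᶜ +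
      ∑ i : Fin 2, ∑ X : Λ, ∑ Y : Λ, if st i X Y ∧ ¬ (X ∈ R ∧ Y ∈ R) then b i X Y else 0 := by
    rw [hH, hH, onSiteSum_univ_eq_add_compl (U : ℂ) (μ : ℂ) R]
    have key : ∀ (i : Fin 2) (X Y : Λ),
        ((if X ∈ (Finset.univ : Finset Λ) ∧ Y ∈ (Finset.univ : Finset Λ) ∧ st i X Y then b i X Y else 0) -
          if X ∈ R ∧ Y ∈ R ∧ st i X Y then b i X Y else 0) =
        if st i X Y ∧ ¬ (X ∈ R ∧ Y ∈ R) then b i X Y else 0 := by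
      intro i X Y
      simp only [Finset.mem_univ, true_and]
      by_cases h1 : st i X Y <;> by_cases h2 : X ∈ R ∧ Y ∈ R <;> simp [h1, h2]
    simp only [← key, Finset.sum_sub_distrib]
    abel
  rw [hdiff]
  refine (norm_add_le _ _).trans ?_
  have h1 := norm_onSiteSum_le U μ Rᶜ
  have h2 := norm_sum_sum_sum_ite_le (fun i X Y => st i X Y ∧ ¬ (X ∈ R ∧ Y ∈ R)) b
    (fun i X Y h => hbC i X Y)
  -- each direction contributes at most `2 #Rᶜ` bonds not inside `R`
  have h3 : ∀ i : Fin 2, (((Finset.univ ×ˢ Finset.univ).filter fun q : Λ × Λ =>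
      st i q.1 q.2 ∧ ¬ (q.1 ∈ R ∧ q.2 ∈ R)).card : ℝ) ≤ 2 * Rᶜ.card := by
    intro i
    have hsub : ((Finset.univ ×ˢ Finset.univ).filter fun q : Λ × Λ => st i q.1 q.2 ∧ ¬ (q.1 ∈ R ∧ q.2 ∈ R)) ⊆
        ((Finset.univ ×ˢ Finset.univ).filter fun q : Λ × Λ => st i q.1 q.2 ∧ q.1 ∉ R) ∪
          ((Finset.univ ×ˢ Finset.univ).filter fun q : Λ × Λ => st i q.1 q.2 ∧ q.2 ∉ R) := by
      intro q hq
      rw [Finset.mem_filter] at hq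
      rw [Finset.mem_union, Finset.mem_filter, Finset.mem_filter]
      by_cases h : q.1 ∈ R
      · exact Or.inr ⟨hq.1, hq.2.1, fun h' => hq.2.2 ⟨h, h'⟩⟩
      · exact Or.inl ⟨hq.1, hq.2.1, h⟩
    have ha := card_filter_pair_le_fst (fun X Y => st i X Y ∧ X ∉ R) (fun X => X ∉ R)
      (fun X Y Y' h h' => hR i X Y Y' h.1 h'.1) (fun X Y h => h.2)
    have hb2 := card_filter_pair_le_snd (fun X Y => st i X Y ∧ Y ∉ R) (fun Y => Y ∉ R)
      (fun X X' Y h h' => hL i X X' Y h.1 h'.1) (fun X Y h => h.2)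
    have hc : (Finset.univ.filter fun X : Λ => X ∉ R) = Rᶜ := by ext X; simp
    rw [hc] at ha hb2
    have := (Finset.card_le_card hsub).trans ((Finset.card_union_le _ _).trans (add_le_add ha hb2))
    have : (((Finset.univ ×ˢ Finset.univ).filter fun q : Λ × Λ =>
      st i q.1 q.2 ∧ ¬ (q.1 ∈ R ∧ q.2 ∈ R)).card : ℝ) ≤ Rᶜ.card + Rᶜ.card := by exact_mod_cast this
    linarith
  have h4 : C * ∑ i : Fin 2, (((Finset.univ ×ˢ Finset.univ).filter fun q : Λ × Λ =>
      st i q.1 q.2 ∧ ¬ (q.1 ∈ R ∧ q.2 ∈ R)).card : ℝ) ≤ C * (4 * Rᶜ.card) := by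
    refine mul_le_mul_of_nonneg_left ?_ hC0
    rw [Fin.sum_univ_two]
    have := h3 0; have := h3 1; linarith
  have : (Rᶜ.card : ℝ) * (|U| + 2 * |μ| + 4 * C) = Rᶜ.card * (|U| + 2 * |μ|) + C * (4 * Rᶜ.card) := by ring
  rw [this]
  exact add_le_add h1 (h2.trans h4)

/-- **Cut bound**: for a block map `g : Λ → J` (fibres `R_j`, `j ∈ t ⊇ g(Λ)`), right-unique steps,
and predicates `P_i` marking the sites whose `i`-step leaves their block,
`‖H Λ − Σ_{j ∈ t} H R_j‖ ≤ (4 + 4(‖κ₀‖ + ‖κ₁‖)) Σ_i #P_i`. [folklore] -/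
theorem norm_regionHam_univ_sub_sum_le
    (hb : ∀ (i : Fin 2) (X Y : Λ), b i X Y =
      (∑ σ : Fin 2, ((-1 : ℂ) • (creation (orb X σ) * annihilation (orb Y σ)) +
        ((-1 : ℂ) • (creation (orb X σ) * annihilation (orb Y σ)))ᴴ)) +
      (κ i • (annihilation (orb X 0) * annihilation (orb Y 1) - annihilation (orb X 1) * annihilation (orb Y 0)) +
        (κ i • (annihilation (orb X 0) * annihilation (orb Y 1) -
          annihilation (orb X 1) * annihilation (orb Y 0)))ᴴ))
    (hH : ∀ R : Finset Λ, H R = onSiteSum (U : ℂ) (μ : ℂ) R +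
      ∑ i : Fin 2, ∑ X : Λ, ∑ Y : Λ, if X ∈ R ∧ Y ∈ R ∧ st i X Y then b i X Y else 0)
    (hR : ∀ i X Y Y', st i X Y → st i X Y' → Y = Y')
    {J : Type*} [DecidableEq J] (g : Λ → J) (t : Finset J) (hg : ∀ X, g X ∈ t)
    (P : Fin 2 → Λ → Prop) [∀ i, DecidablePred (P i)] (hP : ∀ i X Y, st i X Y → g X ≠ g Y → P i X) :
    ‖H Finset.univ - ∑ j ∈ t, H (Finset.univ.filter fun X => g X = j)‖ ≤
      (4 + 4 * (‖κ 0‖ + ‖κ 1‖)) * ∑ i : Fin 2, ((Finset.univ.filter (P i)).card : ℝ) := by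
  set C : ℝ := 4 + 4 * (‖κ 0‖ + ‖κ 1‖) with hC
  have hC0 : 0 ≤ C := by positivity
  have hκ : ∀ i : Fin 2, ‖κ i‖ ≤ ‖κ 0‖ + ‖κ 1‖ := fun i => by
    fin_cases i
    · exact le_add_of_nonneg_right (norm_nonneg _)
    · exact le_add_of_nonneg_left (norm_nonneg _)
  have hbC : ∀ i X Y, ‖b i X Y‖ ≤ C := fun i X Y =>
    (norm_bondOp'_le hb i X Y).trans (by rw [hC]; linarith [hκ i])
  -- the on-site parts agree (the fibres partition `Λ`)
  have hV : ∑ j ∈ t, onSiteSum (U : ℂ) (μ : ℂ) (Finset.univ.filter fun X => g X = j) =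
      onSiteSum (U : ℂ) (μ : ℂ) Finset.univ := by
    simp only [onSiteSum]
    exact Finset.sum_fiberwise_of_maps_to (fun X _ => hg X) _
  -- the bond parts: only the bonds across blocks survive
  have hB : ∀ (i : Fin 2) (X Y : Λ),
      ((if X ∈ (Finset.univ : Finset Λ) ∧ Y ∈ (Finset.univ : Finset Λ) ∧ st i X Y then b i X Y else 0) -
        ∑ j ∈ t, if X ∈ (Finset.univ.filter fun X => g X = j) ∧ Y ∈ (Finset.univ.filter fun X => g X = j) ∧
          st i X Y then b i X Y else 0) =
      if st i X Y ∧ g X ≠ g Y then b i X Y else 0 := by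
    intro i X Y
    simp only [Finset.mem_univ, true_and, Finset.mem_filter]
    have hs : (∑ j ∈ t, if g X = j ∧ g Y = j ∧ st i X Y then b i X Y else 0) =
        if g Y = g X ∧ st i X Y then b i X Y else 0 := by
      rw [Finset.sum_eq_single (g X)]
      · by_cases h : g Y = g X ∧ st i X Y
        · rw [if_pos h, if_pos ⟨rfl, h.1, h.2⟩]
        · rw [if_neg h, if_neg (fun h' => h ⟨h'.2.1, h'.2.2⟩)]
      · intro j _ hj
        rw [if_neg (fun h' => hj h'.1.symm)]
      · intro h
        exact absurd (hg X) h
    rw [hs]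
    by_cases h1 : st i X Y
    · by_cases h2 : g Y = g X
      · rw [if_pos h1, if_pos ⟨h2, h1⟩, if_neg (fun h => h.2 h2.symm), sub_self]
      · rw [if_pos h1, if_neg (fun h => h2 h.1), if_pos ⟨h1, fun h => h2 h.symm⟩, sub_zero]
    · rw [if_neg h1, if_neg (fun h => h1 h.2), if_neg (fun h => h1 h.1), sub_zero]
  have hdiff : H Finset.univ - ∑ j ∈ t, H (Finset.univ.filter fun X => g X = j) =
      ∑ i : Fin 2, ∑ X : Λ, ∑ Y : Λ, if st i X Y ∧ g X ≠ g Y then b i X Y else 0 := by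
    simp only [hH, Finset.sum_add_distrib, ← hV]
    rw [add_sub_add_left_eq_sub]
    rw [Finset.sum_comm (s := t)]
    simp only [← Finset.sum_sub_distrib]
    refine Finset.sum_congr rfl fun i _ => ?_
    rw [Finset.sum_comm (s := t)]
    simp only [← Finset.sum_sub_distrib]
    refine Finset.sum_congr rfl fun X _ => ?_
    rw [Finset.sum_comm (s := t)]
    simp only [← Finset.sum_sub_distrib]
    exact Finset.sum_congr rfl fun Y _ => hB i X Y
  rw [hdiff]
  refine (norm_sum_sum_sum_ite_le (fun i X Y => st i X Y ∧ g X ≠ g Y) b (fun i X Y _ => hbC i X Y)).trans ?_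
  refine mul_le_mul_of_nonneg_left (Finset.sum_le_sum fun i _ => ?_) hC0
  exact_mod_cast card_filter_pair_le_fst (fun X Y => st i X Y ∧ g X ≠ g Y) (P i)
    (fun X Y Y' h h' => hR i X Y Y' h.1 h'.1) (fun X Y h => hP i X Y h.1 h.2)

end Region

/-! ### Summary (registered sub-goal of stmt-HubbardSuperconductivity-15581) -/

/-- **Registered sub-goal `spl_regionHamCutBound`** (layer 2 of `stub_sourcedPressureLimit`): the cut
bound for the regional Hamiltonians of the sourced Hubbard model on an abstract vertex set. [folklore] -/
theorem spl_regionHamCutBound : ∀ (Λ : Type) [LinearOrder Λ] [Fintype Λ] (κ : Fin 2 → ℂ) (U μ : ℝ) (b : Fin 2 → Λ → Λ → Matrix (Finset (Orb Λ)) (Finset (Orb Λ)) ℂ) (st : Fin 2 → Λ → Λ → Prop) [∀ i, DecidableRel (st i)] (H : Finset Λ → Matrix (Finset (Orb Λ)) (Finset (Orb Λ)) ℂ), (∀ (i : Fin 2) (X Y : Λ), b i X Y = (∑ σ : Fin 2, ((-1 : ℂ) • (creation (orb X σ) * annihilation (orb Y σ)) + ((-1 : ℂ) • (creation (orb X σ)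 * annihilation (orb Y σ)))ᴴ)) + (κ i • (annihilation (orb X 0) * annihilation (orb Y 1) - annihilation (orb X 1) * annihilation (orb Y 0)) + (κ i • (annihilation (orb X 0) * annihilation (orb Y 1) - annihilation (orb X 1) * annihilation (orb Y 0)))ᴴ)) → (∀ R : Finset Λ, H R = onSiteSum (U : ℂ) (μ : ℂ) R + ∑ i : Fin 2, ∑ X : Λ, ∑ Y : Λ, if X ∈ R ∧ Y ∈ R ∧ st i X Y then b i X Y else 0) → (∀ i X Y Y', st i X Y → st i X Y' → Y = Y') → ∀ (J : Type) [DecidableEq J] (g : Λ → J) (t : Finset J), (∀ X, g X ∈ t) → ∀ (P : Fin 2 → Λ → Prop) [∀ i, DecidablePred (P i)], (∀ i X Y, st i X Y → g X ≠ g Y → P i X) → ‖H Finset.univ - ∑ j ∈ t, H (Finset.univ.filter fun X => g X = j)‖ ≤ (4 + 4 * (‖κ 0‖ + ‖κ 1‖)) * ∑ i : Fin 2, ((Finset.univ.filter (P i)).card : ℝ) :=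
  fun _ _ _ _ _ _ _ _ _ _ hb hH hR _ _ g t hg P _ hP => norm_regionHam_univ_sub_sum_le hb hH hR g t hg P hP

end

end Summit.HubbardSuperconductivity.HubbardSuperconductivity.Theorems.TwSeededEnsembleEquivalenceR.ColdFloorLine
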